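import Mathlib
import Literature.MathematicalPhysics.QuantumLattice.KohnLuttinger
import HarnessLib
import Literature.Analysis.SpecialFunctions.ArcsinPowerSeries

/-!
KL-MARGIN-SCAN · reader idea-2 (lens «control») · round 5 — `Theorems/WeakCouplingBCSKlBlaschkeTransplant.lean`
(helper, supports stmt-HubbardSuperconductivity-0158) — PART A of a pure three-file cut of the x-read prestage
91f4b14c7a1eabde (561 l. > the 400-line cap; crit-1 KL STATUS l.10099): §0 two inequalities, §1 the level algebra
`s, A, μ̃, C`, the exact factorisation of `ε_{t′} − μ` and `level_iff_mobius`.  PART B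
(`…Theorems/WeakCouplingBCSKlBlaschkeTransplantMap.lean`, imports this file) = §2 the Blaschke boundary phase `β_a`,
§3 the transplant map `Φ_a`; PART C (`…Theorems/WeakCouplingBCSKlBlaschkeTransplantTargets.lean`, imports B) = §4 the
typed targets T1–T3 + the order corollary.  No statement changed (docstrings added); 0 sorry.

THE BLASCHKE TRANSPLANT of the t–t′ Fermi curve.  For |t′| < 1/2 and t′μ < 1 put
  s = √(1 − t′μ),   A = 2t′/(1+s)  (the root of μA² − 4A + 4t′ = 0 in (−1,1)),   μ̃ = (μ − 4t′)/s,
  C = s(1+s)²/((1+s)² − 4t′²)  (= s/(1 − A²)),   T_A(c) = (c + A)/(1 + Ac)  (a Möbius self-map of [−1,1]).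
  PROVED here (no sorry):
  (1) ε_{t′}(k) − μ = C·[−2((cos k₀ + A)(1 + A cos k₁) + (cos k₁ + A)(1 + A cos k₀)) − μ̃(1 + A cos k₀)(1 + A cos k₁)]
                    = C(1 + A cos k₀)(1 + A cos k₁)·[−2(T_A(cos k₀) + T_A(cos k₁)) − μ̃]            (exact factorisation);
      hence  ε_{t′}(k) = μ ⟺ −2(T_A(cos k₀) + T_A(cos k₁)) = μ̃;  A solves μA² − 4A + 4t′ = 0;  C(1 − A²) = s;
      Van Hove μ = 4t′ ↦ μ̃ = 0; band edges ∓4 − 4t′… ↦ ∓4.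
Honest framing: nothing here is a statement about superconductivity; a Kohn–Luttinger statement is not ODLRO;
no margin, window, U₀ or K₃ claim is made.
-/

set_option linter.dupNamespace false
set_option linter.style.longLine false

noncomputable section

namespace Summit.HubbardSuperconductivity.HubbardSuperconductivity.Theorems.KlBlaschkeTransplant

open Real MeasureTheory Literature.MathematicalPhysics.QuantumLattice

/-! ### §0 Two elementary inequalities -/

/-- `1 + A·c > 0` whenever `|A| < 1` and `|c| ≤ 1` (positivity of the Möbius denominator). -/
theorem one_add_mul_pos {A c : ℝ} (hA : |A| < 1) (hc : |c| ≤ 1) : 0 < 1 + A * c := by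
  have h1 : |A * c| ≤ |A| := by
    rw [abs_mul]; exact mul_le_of_le_one_right (abs_nonneg _) hc
  have h2 := neg_abs_le (A * c)
  linarith

/-- `|2a/(1+a²)| < 1` for `|a| < 1`. -/
theorem abs_two_mul_div_lt_one {a : ℝ} (ha : |a| < 1) : |2 * a / (1 + a ^ 2)| < 1 := by
  have h0 : (0:ℝ) < 1 + a ^ 2 := by positivity
  rw [abs_div, abs_of_pos h0, div_lt_one h0, abs_mul, abs_two]
  have h1 : 0 < (1 - |a|) ^ 2 := by
    have : 0 < 1 - |a| := by linarith
    positivity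
  nlinarith [sq_abs a]

/-! ### §1 The level algebra `s, A, μ̃, C` and the exact factorisation of `ε_{t′} − μ` -/

/-- `s(t′, μ) = √(1 − t′μ)`. -/
def klS (tp μ : ℝ) : ℝ := Real.sqrt (1 - tp * μ)

/-- The Blaschke/Möbius parameter `A(t′, μ) = 2t′/(1 + s)`. -/
def klA (tp μ : ℝ) : ℝ := 2 * tp / (1 + klS tp μ)

/-- The transplanted nearest-neighbour level `μ̃(t′, μ) = (μ − 4t′)/s`. -/
def klMuT (tp μ : ℝ) : ℝ := (μ - 4 * tp) / klS tp μ

/-- The conformal factor `C(t′, μ) = s(1+s)²/((1+s)² − 4t′²) = s/(1 − A²)`. -/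
def klC (tp μ : ℝ) : ℝ := klS tp μ * (1 + klS tp μ) ^ 2 / ((1 + klS tp μ) ^ 2 - 4 * tp ^ 2)

/-- The real Möbius map `T_A(c) = (c + A)/(1 + A c)`. -/
def mobius (A c : ℝ) : ℝ := (c + A) / (1 + A * c)

variable {tp μ a : ℝ}

/-- `s = √(1 − t′μ) > 0` on the admissible region `t′μ < 1`. -/
theorem klS_pos (hμ : tp * μ < 1) : 0 < klS tp μ := Real.sqrt_pos.2 (by linarith)

/-- `s² = 1 − t′μ`. -/
theorem klS_sq (hμ : tp * μ < 1) : klS tp μ ^ 2 = 1 - tp * μ := Real.sq_sqrt (by linarith)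

/-- The denominator of `C`, `(1 + s)² − 4t′²`, is positive for `|t′| < 1/2`. -/
theorem klDen_pos (htp : |tp| < 1 / 2) (hμ : tp * μ < 1) : 0 < (1 + klS tp μ) ^ 2 - 4 * tp ^ 2 := by
  have hs := klS_pos hμ
  have h := abs_lt.mp htp
  nlinarith [h.1, h.2]

/-- `C = s(1+s)²/((1+s)² − 4t′²) > 0`. -/
theorem klC_pos (htp : |tp| < 1 / 2) (hμ : tp * μ < 1) : 0 < klC tp μ := by
  have hs := klS_pos hμ
  unfold klC
  exact div_pos (by positivity) (klDen_pos htp hμ)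

/-- `|A| = |2t′/(1 + s)| < 1` for `|t′| < 1/2`, so `T_A` is a self-map of `[−1, 1]`. -/
theorem abs_klA_lt_one (htp : |tp| < 1 / 2) (hμ : tp * μ < 1) : |klA tp μ| < 1 := by
  have hs := klS_pos hμ
  have h1 : (0:ℝ) < 1 + klS tp μ := by linarith
  unfold klA
  rw [abs_div, abs_of_pos h1, div_lt_one h1, abs_mul, abs_two]
  linarith

/-- `A` solves `μA² − 4A + 4t′ = 0`. -/
theorem klA_quadratic (hμ : tp * μ < 1) : μ * klA tp μ ^ 2 - 4 * klA tp μ + 4 * tp = 0 := by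
  have hs := klS_pos hμ
  have hs2 := klS_sq hμ
  have hA : klA tp μ * (1 + klS tp μ) = 2 * tp := by
    unfold klA; field_simp
  have key : (1 + klS tp μ) ^ 2 * (μ * klA tp μ ^ 2 - 4 * klA tp μ + 4 * tp) = 0 := by
    linear_combination (μ * (klA tp μ * (1 + klS tp μ) + 2 * tp) - 4 * (1 + klS tp μ)) * hA
      + (4 * tp) * hs2
  have h1 : (1 + klS tp μ) ^ 2 ≠ 0 := by positivity
  exact (mul_eq_zero.1 key).resolve_left h1

/-- `C(1 − A²) = s`. -/
theorem klC_mul_one_sub_sq (htp : |tp| < 1 / 2) (hμ : tp * μ < 1) :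
    klC tp μ * (1 - klA tp μ ^ 2) = klS tp μ := by
  have hs := klS_pos hμ
  have h1 : (1:ℝ) + klS tp μ ≠ 0 := by linarith
  have hD := (klDen_pos htp hμ).ne'
  unfold klC klA
  field_simp
  ring

/-- Van Hove: the saddle level `μ = 4t′` is transplanted to the NN Van Hove level `0`. -/
theorem klMuT_vanHove (tp : ℝ) : klMuT tp (4 * tp) = 0 := by simp [klMuT]

/-- `sign μ̃ = sign(μ − 4t′)`: Γ-centred (`μ̃ < 0`) vs M-centred (`μ̃ > 0`) Fermi sea. -/
theorem klMuT_pos_iff (hμ : tp * μ < 1) : 0 < klMuT tp μ ↔ 4 * tp < μ := by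
  rw [klMuT, div_pos_iff_of_pos_right (klS_pos hμ), sub_pos]

/-- At the band bottom `μ = −4 − 4t′` one has `s = 1 + 2t′`. -/
theorem klS_band_bottom (htp : |tp| < 1 / 2) : klS tp (-4 - 4 * tp) = 1 + 2 * tp := by
  rw [klS, show 1 - tp * (-4 - 4 * tp) = (1 + 2 * tp) ^ 2 by ring]
  exact Real.sqrt_sq (by linarith [(abs_lt.mp htp).1])

/-- At the band top `μ = 4 − 4t′` one has `s = 1 − 2t′`. -/
theorem klS_band_top (htp : |tp| < 1 / 2) : klS tp (4 - 4 * tp) = 1 - 2 * tp := by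
  rw [klS, show 1 - tp * (4 - 4 * tp) = (1 - 2 * tp) ^ 2 by ring]
  exact Real.sqrt_sq (by linarith [(abs_lt.mp htp).2])

/-- The band bottom `−4 − 4t′` is transplanted to the NN band bottom `−4`. -/
theorem klMuT_band_bottom (htp : |tp| < 1 / 2) : klMuT tp (-4 - 4 * tp) = -4 := by
  have h : (1:ℝ) + 2 * tp ≠ 0 := by linarith [(abs_lt.mp htp).1]
  rw [klMuT, klS_band_bottom htp, div_eq_iff h]
  ring

/-- The band top `4 − 4t′` is transplanted to the NN band top `4`. -/
theorem klMuT_band_top (htp : |tp| < 1 / 2) : klMuT tp (4 - 4 * tp) = 4 := by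
  have h : (1:ℝ) - 2 * tp ≠ 0 := by linarith [(abs_lt.mp htp).2]
  rw [klMuT, klS_band_top htp, div_eq_iff h]
  ring

/-- **The exact factorisation** (polynomial form). -/
theorem squareDispersion_sub_level (htp : |tp| < 1 / 2) (hμ : tp * μ < 1) (k : Momentum) :
    squareDispersion 1 tp k - μ
      = klC tp μ * (-2 * ((cos (k 0) + klA tp μ) * (1 + klA tp μ * cos (k 1))
                          + (cos (k 1) + klA tp μ) * (1 + klA tp μ * cos (k 0)))
                    - klMuT tp μ * ((1 + klA tp μ * cos (k 0)) * (1 + klA tp μ * cos (k 1)))) := by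
  rcases eq_or_ne tp 0 with rfl | htp0
  · have h1 : klS 0 μ = 1 := by simp [klS]
    simp only [klC, klA, klMuT, squareDispersion, h1]
    ring
  · have hs := klS_pos hμ
    have hs2 := klS_sq hμ
    have hD := (klDen_pos htp hμ).ne'
    have hμ' : μ = (1 - klS tp μ ^ 2) / tp := by
      rw [hs2]; field_simp; ring
    simp only [klC, klA, klMuT, squareDispersion]
    generalize hsg : klS tp μ = s at *
    have h1 : (1:ℝ) + s ≠ 0 := by linarith
    have h2 : s ≠ 0 := hs.ne'
    subst hμ'
    field_simp
    ring

/-- **The exact factorisation** (Möbius form). -/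
theorem squareDispersion_sub_level_mobius (htp : |tp| < 1 / 2) (hμ : tp * μ < 1) (k : Momentum) :
    squareDispersion 1 tp k - μ
      = klC tp μ * (1 + klA tp μ * cos (k 0)) * (1 + klA tp μ * cos (k 1))
          * (-2 * (mobius (klA tp μ) (cos (k 0)) + mobius (klA tp μ) (cos (k 1))) - klMuT tp μ) := by
  have hA := abs_klA_lt_one htp hμ
  have h0 := (one_add_mul_pos hA (abs_cos_le_one (k 0))).ne'
  have h1 := (one_add_mul_pos hA (abs_cos_le_one (k 1))).ne'
  have e0 : mobius (klA tp μ) (cos (k 0)) * (1 + klA tp μ * cos (k 0)) = cos (k 0) + klA tp μ := by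
    unfold mobius; exact div_mul_cancel₀ _ h0
  have e1 : mobius (klA tp μ) (cos (k 1)) * (1 + klA tp μ * cos (k 1)) = cos (k 1) + klA tp μ := by
    unfold mobius; exact div_mul_cancel₀ _ h1
  rw [squareDispersion_sub_level htp hμ k, ← e0, ← e1]
  ring

/-- Level sets correspond: `ε_{t′}(k) = μ ⟺ −2(T_A(cos k₀) + T_A(cos k₁)) = μ̃`. -/
theorem level_iff_mobius (htp : |tp| < 1 / 2) (hμ : tp * μ < 1) (k : Momentum) :
    squareDispersion 1 tp k = μ
      ↔ -2 * (mobius (klA tp μ) (cos (k 0)) + mobius (klA tp μ) (cos (k 1))) = klMuT tp μ := by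
  have hA := abs_klA_lt_one htp hμ
  have hP : klC tp μ * (1 + klA tp μ * cos (k 0)) * (1 + klA tp μ * cos (k 1)) ≠ 0 := by
    have := klC_pos htp hμ
    have := one_add_mul_pos hA (abs_cos_le_one (k 0))
    have := one_add_mul_pos hA (abs_cos_le_one (k 1))
    positivity
  rw [← sub_eq_zero (a := squareDispersion 1 tp k), squareDispersion_sub_level_mobius htp hμ k, mul_eq_zero,
    or_iff_right hP, sub_eq_zero]

end Summit.HubbardSuperconductivity.HubbardSuperconductivity.Theorems.KlBlaschkeTransplant

end
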